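import Summits.QuantumFields.YangMills.Theorems.UnitScaleTiltProp7ChartPiecesTw
import Summits.QuantumFields.YangMills.Theorems.UnitScaleTiltProp7SymAvgTwSymEq137
import Summits.QuantumFields.YangMills.Theorems.UnitScaleTiltProp7SPrintDefsS
import HarnessLib

/-!
# Route `UnitScaleTilt`, crux K1 child «MinimiserStabilityRegPr» (stmt-QuantumFields-19200), skeleton v10, stub `stub_existenceMinimalOrbit` (EX), route (α) — **(CH-KNIT v2ˢ) FILE Aˢ:
# CHART-112ˢ AT ONE MEMBER FROM THE PIECES OF THE CHART OF RECORD** (★★OWNER RULING g26-№12 «EX frames of record := symmetric centre-anchored, `logChartTwS`∕`QTwS`∕`CmapTwS`∕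
# `Chart47T3twS`» + RULING g26-№19 «(α-S): `hChart`'s (20) conjunct → `AvgCondPrintS` with the explicit witness (FILE Aˢ `hChart_of_piecesTwS`: NO CHART-Σ supplier, (WΣ) gone)»):
# the (α-S) twin of ✓`Prop7ChartPiecesTw.hChart_of_piecesTw` — (20) now comes from ✓`Prop7SymAvgTwSymEq137.fibreClauseS_of_chart47twS` (the S chart's level set IS the symmetric slice)
# and the DISPLAYED witness row «∃ u, NormS U₀ X (e^{iX}) u» (the axial gauge transformation with the prescribed top-centre data `(w^{sym}_{iX})⁻¹`), in place of CHART-Σ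

Cell `ym3-torus`, width seat `ym-ust-19200-w2` (gen 3; EX KNIT RULER, RULING g26-№19 ORDER (2)(i), file F4).  THEOREMS ONLY (0 `def`, 0 `sorry`).  By-name junction: nothing here
closes the stub; `--supports stmt-QuantumFields-19200 --as helper`, count-neutral.  YM₃ on T³ is a ladder rung (R3), not the Clay problem; nothing here claims the stub, the crux,
d = 4 or the mass gap.

THE PRINT.  [Balaban1985Variational] p. 294 (112) «U₁ = exp iη(A′ − HD(A′))», Prop. 5 p. 294, Prop. 3 p. 289 with (47)–(49) p. 285; p. 281 (19)–(21); [Balaban1985RegularSpaces]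
(1.28)–(1.31) pp. 81–82 (the slice «U′ = (U₁U₀)^u axial, Ũ′ʲ = VŪ₀ʲ⁻¹»), (1.37) p. 82, Prop. 7 p. 98 (regularity of the chart point); [Balaban1985Averaging] (87) p. 31 (the witness'
centre values = inverse accumulated frames — here the SYMMETRIC ones, `frameTwS`, by RULING g26-№12∕№19), (89)–(92) p. 31.

WHAT IS PROVED (sorry-free, no definition).  ★★ **`hChart_of_piecesTwS`** — at one member `(F, n, K)` and background `U₀ ∈ 𝔘_k(ε₀)` with `|Ū₀ − V| < b ≤ 1`: Prop. 3 for the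
chart of record `Chart47T3twS … C₂ ε U₀ H` with (45)–(46)-twˢ `QTwS U₀ ∘ H = id` (DISPLAYED); the CHART-ΣS witness row `hWit` (DISPLAYED: for Hermitian-traceless `X` of (19)-size
`< e`, an axial `u` with `u↓ = (w^{sym}_{iX})⁻¹`, i.e. `NormS U₀ X (e^{iX}) u`); the `log` window `hwin` of `dbarTwS` at such chart points (DISPLAYED; supplier ✓`Prop7DbarTwSymWindow`);
and the displayed remainder `hXtw` (∃ A′ X: `‖A′‖ < ε`, `QTwS U₀ A′ = log(V·Ū₀⁻¹)`, `X` Hermitian-traceless, `A′ − H·Dfix(CmapTwS U₀) H C₂ A′ = iX`, (19)-size, (21), E–L at the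
`NormS`-representatives) — give, under `0 ≤ M`, `M(ε₄ + ‖H₁B‖) < e`, `e ≤ 1∕20`, `ε₀ ≤ 1∕16`, `10⁷L³·178(ε₀ + e) ≤ 1`, the five-conjunct CHART-112ˢ: `X` Hermitian-traceless, (19)-size,
**(20)ˢ `AvgCondPrintS V U₀ X`** (witness ∘ ✓`fibreClauseS_of_chart47twS` ∘ [Balaban1985RegularSpaces] Prop. 7 ✓`regPr_emb15_of_in19`), (21), E–L.  HONEST SCOPE: junction
bookkeeping; XL content stays in `hXtw`, the witness and the window are displayed rows with named suppliers.

References: T. Bałaban, CMP 102 (1985) 277–309 [Balaban1985Variational] ((19)–(21) p.281, (47)–(49) p.285, Prop. 3 p.289, (102)–(103) p.293, (112) p.294, Prop. 5 p.294, p.299);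
CMP 99 (1985) 75–102 [Balaban1985RegularSpaces] ((1.19) p.79, (1.28)–(1.31) pp.81–82, (1.37) p.82, Prop. 7 p.98); CMP 98 (1985) 17–51 [Balaban1985Averaging] ((87) p.31, (89)–(92) p.31).
-/

set_option autoImplicit false

noncomputable section

open scoped Matrix.Norms.L2Operator

namespace Summit.QuantumFields.YangMills.Theorems.Prop7ChartPiecesTwS

open NormedSpace
open Literature.MathematicalPhysics.QuantumFieldTheory.Balaban1983to89
open Literature.MathematicalPhysics.QuantumFieldTheory.Balaban1983to89.T3ContinuumYM3Torus
open Literature.MathematicalPhysics.QuantumFieldTheory.Balaban1983to89.T3UnitLawDensityEML (ℰp)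
open Literature.MathematicalPhysics.QuantumFieldTheory.Balaban1983to89.T3TiltDescent (descendTo)
open Literature.MathematicalPhysics.QuantumFieldTheory.Balaban1983to89.T3ConstrainedMinimiser (fibre)
open Literature.MathematicalPhysics.QuantumFieldTheory.Balaban1983to89.T3PrintedRegularMinimiser (RegPr)
open Literature.MathematicalPhysics.QuantumFieldTheory.Balaban1983to89.T3PrintedMinimiserExistence (regPr_mono)
open Literature.MathematicalPhysics.QuantumFieldTheory.Balaban1983to89.T3SectALandauChart (In19 emb15 CloseAvg)
open B9SectCLatticeCarrier (Bond)
open B10Eq27TorusAxialLog (unitsField toUField val_unitsField)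
open B11Eq115Space (NegSize Space115)
open B11Eq111FrakG (nabla115)
open B11Eq98CurrentSlot (Jcur)
open B11Prop3Model (Dfix)
open MatrixLog (mlog)
open Summit.QuantumFields.YangMills.Theorems.Prop7TPrint (nMax19 expHermField expHermField_apply coe_expHerm)
open Summit.QuantumFields.YangMills.Theorems.Prop7SPrint (AvgCondPrintS NormS IsLandauPrint)
open Summit.QuantumFields.YangMills.Theorems.Prop7SectET3Transport (periodsT3 bgOfCfg)
open Summit.QuantumFields.YangMills.Theorems.Prop7SymAvgTwSym (dbarTwS frameTwS QTwS CmapTwS Chart47T3twS)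
open Summit.QuantumFields.YangMills.Theorems.Prop7SymAvgTwSymEq137 (fibreClauseS_of_chart47twS)
open Summit.QuantumFields.YangMills.Theorems.Prop7ChartPiecesTw (norm_datum_sub_one_lt_of_closeAvg)
open Summit.QuantumFields.YangMills.Theorems.Prop7B8Prop7Div (regPr_emb15_of_in19)
open Summit.QuantumFields.YangMills.Theorems.Prop7PV3CDELogChart (in19_expHermField_of_nMax19_lt)

variable (F : T3Family) {n K : ℕ} (h : n ≤ K)

/-! ## CHART-112ˢ at one member from the chart of record, the `NormS` witness, the (20)ˢ fibre theorem and the displayed remainder -/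

/-- ★★ **CHART-112ˢ (five conjuncts) FROM THE PIECES OF THE CHART OF RECORD, one member and background**: `U₀ ∈ 𝔘_k(ε₀)` with `|Ū₀ − V| < b ≤ 1`; print's Prop. 3 for the chart
`Chart47T3twS … C₂ ε U₀ H` with (45)–(46)-twˢ `QTwS U₀ ∘ H = id` (DISPLAYED); the CHART-ΣS witness row `hWit` (DISPLAYED); the `log` window `hwin` of `dbarTwS` at chart points of
(19)-size `< e` (DISPLAYED); and the displayed remainder `hXtw` — every solution `A₁` of (111) in the (115)-ball `ε₄` has a chart parameter `A′`, `‖A′‖ < ε`, with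
`QTwS(U₀)A′ = log(V·Ū₀⁻¹)` ((102)–(103), (20)) and chart image `A′ − H·Dfix(CmapTwS U₀)(A′) = iX`, `X` Hermitian-traceless, `nMax19 X ≤ M(‖A₁‖ + ‖H₁B‖)`, (21), E–L at the
`NormS`-representatives — give, under `0 ≤ M`, `M(ε₄ + ‖H₁B‖) < e`, `e ≤ 1∕20`, `ε₀ ≤ 1∕16`, `10⁷L³·178(ε₀ + e) ≤ 1`, the CHART-112ˢ conclusion: `X` with (19)-size, **(20)ˢ
`AvgCondPrintS`** (the witness `u`, ✓`fibreClauseS_of_chart47twS`, the chart point's regularity by [Balaban1985RegularSpaces] Prop. 7 ✓`regPr_emb15_of_in19`), (21) and E–L.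
[cite: Balaban1985Variational, (112) p.294, Prop. 5 p.294, Prop. 3 p.289, (47)–(49) p.285, (102)–(103) p.293, (19)–(21) p.281, p.299; Balaban1985RegularSpaces, (1.28)–(1.31) pp.81–82, (1.37) p.82, Prop. 7 p.98; Balaban1985Averaging, (87) p.31] -/
theorem hChart_of_piecesTwS [Fact (0 < (F.L : ℝ))] [Fact (0 < ((F.L : ℝ)⁻¹) ^ (K - n))] {ε₀ b ε₄ M e C₂ ε : ℝ}
    (hε₀ : 0 < ε₀) (hε₀16 : ε₀ ≤ 1 / 16) (he0 : 0 < e) (he20 : e ≤ 1 / 20) (hb : b ≤ 1)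
    (hw137 : 10 ^ 7 * (F.L : ℝ) ^ 3 * (178 * (ε₀ + e)) ≤ 1)
    {V : GaugeField (F.P n) 0 (Matrix.specialUnitaryGroup (Fin 2) ℂ)} {U₀ : GaugeField (F.P K) 0 (Matrix.specialUnitaryGroup (Fin 2) ℂ)}
    (hreg : RegPr F n K ε₀ U₀) (hclose : CloseAvg F n K h b V U₀)
    {𝒢 : NegSize (F.L : ℝ) (((F.L : ℝ)⁻¹) ^ (K - n)) (fun _ : Bond 3 (periodsT3 F K) => K - n) 3 (Matrix (Fin 2) (Fin 2) ℂ) →L[ℂ]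
          Space115 (F.L : ℝ) (((F.L : ℝ)⁻¹) ^ (K - n)) (fun _ : Bond 3 (periodsT3 F K) => K - n) (fun _ : Bond 3 (periodsT3 F K) × Fin 3 => K - n)
            (nabla115 (((F.L : ℝ)⁻¹) ^ (K - n)) (bgOfCfg F K U₀))}
    {W : Space115 (F.L : ℝ) (((F.L : ℝ)⁻¹) ^ (K - n)) (fun _ : Bond 3 (periodsT3 F K) => K - n) (fun _ : Bond 3 (periodsT3 F K) × Fin 3 => K - n)
            (nabla115 (((F.L : ℝ)⁻¹) ^ (K - n)) (bgOfCfg F K U₀)) →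
          NegSize (F.L : ℝ) (((F.L : ℝ)⁻¹) ^ (K - n)) (fun _ : Bond 3 (periodsT3 F K) => K - n) 3 (Matrix (Fin 2) (Fin 2) ℂ)}
    {H₁ : (PBond (F.P n) 0 → Matrix (Fin 2) (Fin 2) ℂ) →L[ℂ]
          Space115 (F.L : ℝ) (((F.L : ℝ)⁻¹) ^ (K - n)) (fun _ : Bond 3 (periodsT3 F K) => K - n) (fun _ : Bond 3 (periodsT3 F K) × Fin 3 => K - n)
            (nabla115 (((F.L : ℝ)⁻¹) ^ (K - n)) (bgOfCfg F K U₀))}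
    {B : PBond (F.P n) 0 → Matrix (Fin 2) (Fin 2) ℂ}
    {H : (PBond (F.P n) 0 → Matrix (Fin 2) (Fin 2) ℂ) →ₗ[ℂ] (PBond (F.P K) 0 → Matrix (Fin 2) (Fin 2) ℂ)}
    -- Prop. 3 for the chart of record (symmetric centre-anchored frames) with (45)–(46)-twˢ (DISPLAYED in the knit)
    (h47 : Chart47T3twS F n K h C₂ ε U₀ H) (hQH : ∀ Y, QTwS F n K h U₀ (H Y) = Y)
    -- CHART-ΣS WITNESS: the axial gauge transformation with the prescribed symmetric top-centre data (DISPLAYED; ★w5-20520 g4's row)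
    (hWit : ∀ X : PBond (F.P K) 0 → Matrix (Fin 2) (Fin 2) ℂ, (∀ b : PBond (F.P K) 0, (X b).IsHermitian ∧ Matrix.trace (X b) = 0) → nMax19 F n K U₀ X < e →
      ∃ u : GaugeTransf (F.P K) 0 (Matrix.specialUnitaryGroup (Fin 2) ℂ), NormS F n K h U₀ X (expHermField X) u)
    -- the `log` window of the symmetric-frame average at chart points of (19)-size `< e` (DISPLAYED in the knit; ✓`Prop7DbarTwSymWindow`)
    (hwin : ∀ X : PBond (F.P K) 0 → Matrix (Fin 2) (Fin 2) ℂ, (∀ b : PBond (F.P K) 0, (X b).IsHermitian ∧ Matrix.trace (X b) = 0) → nMax19 F n K U₀ X < e →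
      ∀ c : PBond (F.P n) 0, ‖((dbarTwS F n K h U₀ (fun b => Complex.I • X b) c : (Matrix (Fin 2) (Fin 2) ℂ)ˣ) : Matrix (Fin 2) (Fin 2) ℂ) - 1‖ < 1)
    -- (CH5EL-twˢ) the displayed remainder: (112) ∘ Prop. 5 ∘ (123)–(140) ∘ (102)–(103) ∘ E–L in the letters of record
    (hXtw : ∀ A₁ : Space115 (F.L : ℝ) (((F.L : ℝ)⁻¹) ^ (K - n)) (fun _ : Bond 3 (periodsT3 F K) => K - n) (fun _ : Bond 3 (periodsT3 F K) × Fin 3 => K - n)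
            (nabla115 (((F.L : ℝ)⁻¹) ^ (K - n)) (bgOfCfg F K U₀)),
      ‖A₁‖ < ε₄ → A₁ + 𝒢 (Jcur (bgOfCfg F K U₀)) + 𝒢 (W (A₁ + H₁ B)) = 0 →
        ∃ (A' : PBond (F.P K) 0 → Matrix (Fin 2) (Fin 2) ℂ) (X : PBond (F.P K) 0 → Matrix (Fin 2) (Fin 2) ℂ),
          ‖A'‖ < ε ∧
          QTwS F n K h U₀ A' = (fun c => mlog (((unitsField (toUField V) c * (unitsField (toUField (descendTo F ℰp n K h U₀)) c)⁻¹ :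
              (Matrix (Fin 2) (Fin 2) ℂ)ˣ) : Matrix (Fin 2) (Fin 2) ℂ))) ∧
          (∀ b : PBond (F.P K) 0, (X b).IsHermitian ∧ Matrix.trace (X b) = 0) ∧
          A' - H (Dfix (CmapTwS F n K h U₀) H C₂ A') = (fun b => Complex.I • X b) ∧
          nMax19 F n K U₀ X ≤ M * (‖A₁‖ + ‖H₁ B‖) ∧ IsLandauPrint F n K U₀ X ∧
          (∀ u : GaugeTransf (F.P K) 0 (Matrix.specialUnitaryGroup (Fin 2) ℂ), NormS F n K h U₀ X (expHermField X) u →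
            GaugeField.gaugeAct u (emb15 U₀ (expHermField X)) ∈ fibre F ℰp n K h V →
            ∀ γ : ℝ → GaugeField (F.P K) 0 (Matrix.specialUnitaryGroup (Fin 2) ℂ), γ 0 = GaugeField.gaugeAct u (emb15 U₀ (expHermField X)) →
              (∀ t, γ t ∈ fibre F ℰp n K h V) →
              (∀ b, DifferentiableAt ℝ (fun t => ((γ t b : Matrix.specialUnitaryGroup (Fin 2) ℂ) : Matrix (Fin 2) (Fin 2) ℂ)) 0) →
                deriv (fun t => wilsonAction4 (γ t)) 0 = 0))
    (hM : 0 ≤ M) (hMe : M * (ε₄ + ‖H₁ B‖) < e) :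
    ∀ A₁ : Space115 (F.L : ℝ) (((F.L : ℝ)⁻¹) ^ (K - n)) (fun _ : Bond 3 (periodsT3 F K) => K - n) (fun _ : Bond 3 (periodsT3 F K) × Fin 3 => K - n)
          (nabla115 (((F.L : ℝ)⁻¹) ^ (K - n)) (bgOfCfg F K U₀)),
      ‖A₁‖ < ε₄ → A₁ + 𝒢 (Jcur (bgOfCfg F K U₀)) + 𝒢 (W (A₁ + H₁ B)) = 0 →
        ∃ X : PBond (F.P K) 0 → Matrix (Fin 2) (Fin 2) ℂ,
          (∀ b : PBond (F.P K) 0, (X b).IsHermitian ∧ Matrix.trace (X b) = 0) ∧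
          nMax19 F n K U₀ X ≤ M * (‖A₁‖ + ‖H₁ B‖) ∧ AvgCondPrintS F n K h V U₀ X ∧ IsLandauPrint F n K U₀ X ∧
          (∀ u : GaugeTransf (F.P K) 0 (Matrix.specialUnitaryGroup (Fin 2) ℂ), NormS F n K h U₀ X (expHermField X) u →
            GaugeField.gaugeAct u (emb15 U₀ (expHermField X)) ∈ fibre F ℰp n K h V →
            ∀ γ : ℝ → GaugeField (F.P K) 0 (Matrix.specialUnitaryGroup (Fin 2) ℂ), γ 0 = GaugeField.gaugeAct u (emb15 U₀ (expHermField X)) →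
              (∀ t, γ t ∈ fibre F ℰp n K h V) →
              (∀ b, DifferentiableAt ℝ (fun t => ((γ t b : Matrix.specialUnitaryGroup (Fin 2) ℂ) : Matrix (Fin 2) (Fin 2) ℂ)) 0) →
                deriv (fun t => wilsonAction4 (γ t)) 0 = 0) := by
  intro A₁ hA₁ h111
  obtain ⟨A', X, hA', hQA', hX, hAX, hsize, h21, hEL⟩ := hXtw A₁ hA₁ h111
  refine ⟨X, hX, hsize, ?_, h21, hEL⟩
  -- the (19)-size of `X` is below the witness ∕ window radius `e`
  have hlt : nMax19 F n K U₀ X < e := by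
    have h1 : M * (‖A₁‖ + ‖H₁ B‖) ≤ M * (ε₄ + ‖H₁ B‖) := mul_le_mul_of_nonneg_left (by linarith) hM
    exact lt_of_le_of_lt (hsize.trans h1) hMe
  -- [Balaban1985RegularSpaces] Prop. 7: the chart point `e^{iX}U₀` is printed-regular of radius `178(ε₀ + e)`
  have hL0 : (0 : ℝ) < (F.L : ℝ) := Fact.out
  have hL1 : (1 : ℝ) ≤ (F.L : ℝ) := by have := F.hL.2; exact_mod_cast (by omega : 1 ≤ F.L)
  have hL3 : (1 : ℝ) ≤ (F.L : ℝ) ^ 3 := one_le_pow₀ hL1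
  have hε₂ : ε₀ + e ≤ 1 / 4 := by linarith
  have hε₂0 : 0 < ε₀ + e := by linarith
  have h19 : In19 F n K (ε₀ + e) U₀ (expHermField X) X := in19_expHermField_of_nMax19_lt hX (hlt.trans_le (by linarith))
  have hU₁ : RegPr F n K (178 * (ε₀ + e)) (emb15 U₀ (expHermField X)) := regPr_emb15_of_in19 F n K hε₂ (by linarith) hreg h19
  have hε₁0 : 0 < 178 * (ε₀ + e) := by positivity
  -- the background's window `10⁷L³ε₀ ≤ 1` from `10⁷L³·178(ε₀ + e) ≤ 1`
  have hε₀' : 10 ^ 7 * (F.L : ℝ) ^ 3 * ε₀ ≤ 1 := by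
    have h1 : ε₀ ≤ 178 * (ε₀ + e) := by nlinarith
    have h2 : (0 : ℝ) ≤ 10 ^ 7 * (F.L : ℝ) ^ 3 := by positivity
    exact (mul_le_mul_of_nonneg_left h1 h2).trans hw137
  -- (20)ˢ: the `NormS` witness + the fibre clause of the S chart as a THEOREM (✓`fibreClauseS_of_chart47twS`)
  have hfib := fibreClauseS_of_chart47twS F h hε₀ hε₀' hε₁0 hw137 hreg h47 hQH V A' hA' hQA' hX hAX hU₁ (hwin X hX hlt)
    (norm_datum_sub_one_lt_of_closeAvg F h hb V U₀ hclose)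
  obtain ⟨u, hu⟩ := hWit X hX hlt
  intro U₁ hU₁eq
  have hU₁X : U₁ = expHermField X := by
    funext b'
    apply Subtype.ext
    rw [hU₁eq b', expHermField_apply, coe_expHerm (hX b')]
  subst hU₁X
  exact ⟨u, hu, hfib u hu.2⟩

end Summit.QuantumFields.YangMills.Theorems.Prop7ChartPiecesTwS

end
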